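import Summits.KontsevichZagierPeriods.KontsevichZagierPeriods.Theorems.RootDecompQuadraticDescentEisensteinPairP3

/-!
# Census pair #22 (the ℚ(√−3) pair 4·[□²,1/(3−2N)] ≡ 5·[□²,1/(3−N)], N = u²−uv+v²) and #0 DECIDED in `KZ.relations` by rules 1+2 (route `RootDecompQuadraticDescent`, instances of crux stmt-KontsevichZagierPeriods-28994 / stmt-4280) · part 4/7

Cell `decomp-kz`, lens 6 (decomp-kz-lens-6 g7): `pair22 : 4•[□²,1/(1+2x+2y−2x²+2xy−2y²)] − 5•[□²,1/(2+x+y−x²+xy−y²)] ∈ KZ.relations` (values (5/8)·L(2,χ₋₃), L(2,χ₋₃)/2): reflections → diagonal cut + fold → BLOW-UP (u,k) ↦ (u,uk) via `KZ.of_sub_of_mem_relations_of_affine` → fibre substitution into a LOG BAND over q(u) = 1−u+u² → 23 band relations incl. SEVEN ℚ-rational base substitutions (dihedral symmetries + angle doublings of the Eisenstein conic) + one ℤ-identity; NO Stokes; `pair0` by ONE Möbius substitution y = x/(2−x); packaged `pairs_decided`, `pairs_descentTwoQ_instances`, `pairs_of_kzDimTwo` BY NAME.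

Source: `HOME/decomp-kz-lens-6/g7/EisensteinPair22.lean` sha256 fdb5e0bbc5a4a341 (1894 l; critic decomp-kz-crit-1 g2 CLEARED 2026-08-30T07:59:44Z, std axioms), split into 7 modules by the landing seat decomp-kz-census-1 g7 (contexts re-opened per part; generic docstrings added where the source had none; the route file is imported only by the last part, which proves the `KZDimTwo` corollaries BY NAME).  No `sorry`; standard axioms.  References: [cite: KontsevichZagier2001, §1.2].
-/

noncomputable section

open MeasureTheory Set MvPolynomial

namespace Summit.KontsevichZagierPeriods.RootDecompQuadraticDescent.EisensteinPair

open Literature.NumberTheory.Transcendental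
open Literature.NumberTheory.Transcendental.KZ
open Literature.ModelTheory.ExponentialFields (IsSemialgebraic)

-- PRIVATE copy (landed twin lives in a farm-unbuilt module; dedup.landed): snoc2_zero, snoc2_one, init2_zero
/-- `snoc2_zero`: auxiliary theorem of the lens-6 development «eis» (instances of 28994/4280) — see the module docstring; verbatim from the lens file. -/
@[simp] private theorem snoc2_zero (x : Fin 1 → ℝ) (t : ℝ) : (Fin.snoc x t : Fin 2 → ℝ) 0 = x 0 := rfl

/-- `snoc2_one`: auxiliary theorem of the lens-6 development «eis» (instances of 28994/4280) — see the module docstring; verbatim from the lens file. -/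
@[simp] private theorem snoc2_one (x : Fin 1 → ℝ) (t : ℝ) : (Fin.snoc x t : Fin 2 → ℝ) 1 = t := rfl

/-- `init2_zero`: auxiliary theorem of the lens-6 development «eis» (instances of 28994/4280) — see the module docstring; verbatim from the lens file. -/
@[simp] private theorem init2_zero (z : Fin 2 → ℝ) : Fin.init z 0 = z 0 := rfl

section Core

variable (c : ℚ)

/-- **The core identity**: `2·U_c([0,1], 3/(1+2t−2t²)) − 5·U_c([0,1], 3/((2−t)(1+t))) ∈ KZ.relations`
(in angular terms `4·S₂(60°) − 10·S₂(30°) − 3·S₁(60°) ≡ 0` for the log-cosine integrals). -/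
theorem logCore : 2 • KZ.of (U 0 1 c vA01) - 5 • KZ.of (U 0 1 c vB01) ∈ KZ.relations := by
  -- A-chain
  have a1 := rel_mul 0 1 c vA01 w01 tq01 fun t ht => tq_eq_vA_mul_w ht
  have a2 := rel_cut' 0 (1/2) 1 c w01 w0h wh1 (by norm_num) (by norm_num) (fun t _ => rfl) (fun t _ => rfl)
  have a3 := subst_R2 c
  have a4 := rel_two_half (1/2) 1 c wh1
  have a5 := rel_sq (1/2) 1 (c/2) wh1 wsqh1 fun t _ => by
    show (1 + 2 * t - 2 * t ^ 2) ^ 2 / qf t ^ 2 = wF t * wF t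
    unfold wF; ring
  have a6 := subst_A (c/2)
  have a7 := rel_two_half 0 1 (c/2) cc01
  have a8 := rel_two_half 0 1 c cc01
  have a9 := rel_cut' 0 (1/2) 1 c cc01 cc0h cch1 (by norm_num) (by norm_num) (fun t _ => rfl) (fun t _ => rfl)
  -- linear term
  have l1 := subst_S c
  have l2 := rel_cut' (-1) 0 (1/2) c ccm1h ccm10 cc0h (by norm_num) (by norm_num) (fun t _ => rfl)
    (fun t _ => rfl)
  have l3 := subst_E c
  -- B-chain
  have b1 := rel_mul 0 1 c vB01 wB01 tq01 fun t ht => tq_eq_vB_mul_wB ht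
  have b2 := rel_two_half 0 1 c wB01
  have b3 := rel_sq 0 1 (c/2) wB01 wBsq01 fun t _ => by
    show ((2 - t) * (1 + t)) ^ 2 / qf t ^ 2 = wBF t * wBF t
    unfold wBF; ring
  have b4 := rel_mul 0 1 (c/2) cc01 cp01 wBsq01 fun t _ => by
    show ((2 - t) * (1 + t)) ^ 2 / qf t ^ 2 = ccF t * cpF t
    unfold ccF cpF; ring
  have b5 := subst_R5 (c/2)
  -- sin-doubling chain
  have d1 := rel_mul (1/2) 1 c ssh1 cch1 sscch1 fun t _ => by
    show 3 * t ^ 2 * (2 - t) ^ 2 / (qf t * qf t) = ssF t * ccF t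
    unfold ssF ccF; ring
  have d2 := subst_C c
  have d3 := subst_D c
  have l2h := rel_cut' (-1) 0 (1/2) (c/2) ccm1h ccm10 cc0h (by norm_num) (by norm_num) (fun t _ => rfl)
    (fun t _ => rfl)
  have l3h := subst_E (c/2)
  have p1 := rel_two_half 0 (1/2) c cc0h
  have R := KZ.relations
  convert KZ.relations.add_mem (KZ.relations.zsmul_mem d1 (-2)) <|
    KZ.relations.add_mem (KZ.relations.zsmul_mem d2 (-2)) <|
    KZ.relations.add_mem (KZ.relations.zsmul_mem d3 2) <|
    KZ.relations.add_mem (KZ.relations.zsmul_mem l2h 2) <|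
    KZ.relations.add_mem (KZ.relations.zsmul_mem l3h 2) <|
    KZ.relations.add_mem (KZ.relations.zsmul_mem p1 (-2)) <|
    KZ.relations.add_mem (KZ.relations.zsmul_mem l1 (-3)) <|
    KZ.relations.add_mem (KZ.relations.zsmul_mem l2 (-3)) <|
    KZ.relations.add_mem (KZ.relations.zsmul_mem l3 (-3)) <|
    KZ.relations.add_mem (KZ.relations.zsmul_mem a9 4) <|
    KZ.relations.add_mem (KZ.relations.zsmul_mem a8 (-4)) <|
    KZ.relations.add_mem (KZ.relations.zsmul_mem a7 2) <|
    KZ.relations.add_mem (KZ.relations.zsmul_mem a4 (-4)) <|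
    KZ.relations.add_mem (KZ.relations.zsmul_mem a5 4) <|
    KZ.relations.add_mem (KZ.relations.zsmul_mem a6 (-4)) <|
    KZ.relations.add_mem (KZ.relations.zsmul_mem a2 (-2)) <|
    KZ.relations.add_mem (KZ.relations.zsmul_mem a3 (-2)) <|
    KZ.relations.add_mem (KZ.relations.zsmul_mem a1 (-2)) <|
    KZ.relations.add_mem (KZ.relations.zsmul_mem b1 5) <|
    KZ.relations.add_mem (KZ.relations.zsmul_mem b2 5) <|
    KZ.relations.add_mem (KZ.relations.zsmul_mem b3 (-5)) <|
    KZ.relations.add_mem (KZ.relations.zsmul_mem b4 5) (KZ.relations.zsmul_mem b5 5) using 1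
  abel

end Core

/-! ## Part I: from the census square integrals `[□², 1/(3 − μ·N(1−x,1−y))]` to the bands

Parametric in the level `μ ∈ (0,2]` (`μ = 2`: the A-side `Q_A = 1+2x+2y−2x²+2xy−2y²`;
`μ = 1`: the B-side `Q_B = 2+x+y−x²+xy−y²`), `N(x,y) = x² − xy + y²`. -/

section Geometry

/-! ## The reflection move `xᵢ ↦ 1 − xᵢ` (reproduced from
`Theorems/HermiteRigidityIslandComplementCubeReflection.lean`, HermiteRigidity line, so that this
file only depends on Literature modules) -/

/-- `reflect_reflect`: auxiliary theorem of the lens-6 development «eis» (instances of 28994/4280) — see the module docstring; verbatim from the lens file. -/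
private theorem reflect_reflect {M : ℕ} (i : Fin M) (x : Fin M → ℝ) :
    Function.update (Function.update x i (1 - x i)) i
        (1 - Function.update x i (1 - x i) i) = x := by
  funext j
  rcases eq_or_ne j i with rfl | hj
  · simp
  · simp [Function.update_of_ne hj]

/-- `image_reflect_cube`: auxiliary theorem of the lens-6 development «eis» (instances of 28994/4280) — see the module docstring; verbatim from the lens file. -/
private theorem image_reflect_cube {M : ℕ} (i : Fin M) :
    (fun x : Fin M → ℝ => Function.update x i (1 - x i)) '' cube M = cube M := by
  refine Subset.antisymm ?_ fun y hy => ?_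
  · rintro _ ⟨x, hx, rfl⟩
    exact KZ.update_mem_cube hx i (by linarith [(hx i).2]) (by linarith [(hx i).1])
  · refine ⟨Function.update y i (1 - y i),
      KZ.update_mem_cube hy i (by linarith [(hy i).2]) (by linarith [(hy i).1]), ?_⟩
    exact reflect_reflect i y

/-- `reflectDeriv_apply`: auxiliary theorem of the lens-6 development «eis» (instances of 28994/4280) — see the module docstring; verbatim from the lens file. -/
private theorem reflectDeriv_apply {M : ℕ} (i : Fin M) (v : Fin M → ℝ) (j : Fin M) :
    ((ContinuousLinearMap.id ℝ (Fin M → ℝ) -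
        ((2:ℝ) • ContinuousLinearMap.proj (R := ℝ) (φ := fun _ : Fin M => ℝ) i).smulRight
          (Pi.single i (1:ℝ) : Fin M → ℝ) : (Fin M → ℝ) →L[ℝ] (Fin M → ℝ))) v j = if j = i then -v i else v j := by
  simp only [sub_apply, ContinuousLinearMap.id_apply, ContinuousLinearMap.smulRight_apply,
    smul_apply, ContinuousLinearMap.proj_apply, Pi.sub_apply, Pi.smul_apply, smul_eq_mul,
    Pi.single_apply, mul_ite, mul_one, mul_zero]
  split_ifs with hj
  · subst hj; ring
  · ring

/-- `abs_det_reflectDeriv`: auxiliary theorem of the lens-6 development «eis» (instances of 28994/4280) — see the module docstring; verbatim from the lens file. -/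
private theorem abs_det_reflectDeriv {M : ℕ} (i : Fin M) :
    |((ContinuousLinearMap.id ℝ (Fin M → ℝ) -
        ((2:ℝ) • ContinuousLinearMap.proj (R := ℝ) (φ := fun _ : Fin M => ℝ) i).smulRight
          (Pi.single i (1:ℝ) : Fin M → ℝ) : (Fin M → ℝ) →L[ℝ] (Fin M → ℝ))).det| = 1 := by
  set L := (ContinuousLinearMap.id ℝ (Fin M → ℝ) -
    ((2:ℝ) • ContinuousLinearMap.proj (R := ℝ) (φ := fun _ : Fin M => ℝ) i).smulRight
      (Pi.single i (1:ℝ) : Fin M → ℝ) : (Fin M → ℝ) →L[ℝ] (Fin M → ℝ)) with hL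
  have hinv : (L : (Fin M → ℝ) →ₗ[ℝ] (Fin M → ℝ)).comp (L : (Fin M → ℝ) →ₗ[ℝ] (Fin M → ℝ)) =
      LinearMap.id := by
    refine LinearMap.ext fun v => funext fun j => ?_
    rw [LinearMap.comp_apply, ContinuousLinearMap.coe_coe, LinearMap.id_apply, hL,
      reflectDeriv_apply, reflectDeriv_apply]
    rcases eq_or_ne j i with rfl | hj
    · simp
    · simp [hj]
  have h := congrArg LinearMap.det hinv
  rw [LinearMap.det_comp, LinearMap.det_id] at h
  rw [ContinuousLinearMap.det]
  rcases mul_self_eq_one_iff.mp h with h1 | h1 <;> simp [h1]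

/-- `hasFDerivAt_reflect`: auxiliary theorem of the lens-6 development «eis» (instances of 28994/4280) — see the module docstring; verbatim from the lens file. -/
private theorem hasFDerivAt_reflect {M : ℕ} (i : Fin M) (x : Fin M → ℝ) :
    HasFDerivAt (fun y : Fin M → ℝ => Function.update y i (1 - y i))
      ((ContinuousLinearMap.id ℝ (Fin M → ℝ) -
        ((2:ℝ) • ContinuousLinearMap.proj (R := ℝ) (φ := fun _ : Fin M => ℝ) i).smulRight
          (Pi.single i (1:ℝ) : Fin M → ℝ) : (Fin M → ℝ) →L[ℝ] (Fin M → ℝ))) x := by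
  have h0 : HasFDerivAt (fun y : Fin M → ℝ => 2 * y i - 1)
      ((2:ℝ) • ContinuousLinearMap.proj (R := ℝ) (φ := fun _ : Fin M => ℝ) i) x :=
    ((hasFDerivAt_apply i x).const_mul (2:ℝ)).sub_const 1
  have h1 := (hasFDerivAt_id x).sub (h0.smul_const (Pi.single i (1:ℝ)))
  refine h1.congr_of_eventuallyEq (Filter.Eventually.of_forall fun y => ?_)
  funext j
  simp only [Pi.sub_apply, id_eq, Pi.smul_apply, Pi.single_apply, smul_eq_mul, mul_ite, mul_one,
    mul_zero, Function.update_apply]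
  split_ifs with hj
  · subst hj; ring
  · ring

/-- `isSemialgebraicMapOn_reflect`: auxiliary theorem of the lens-6 development «eis» (instances of 28994/4280) — see the module docstring; verbatim from the lens file. -/
private theorem isSemialgebraicMapOn_reflect {M : ℕ} (i : Fin M) :
    IsSemialgebraicMapOn ℚ (cube M) (fun y : Fin M → ℝ => Function.update y i (1 - y i)) := by
  refine (isSemialgebraicMapOn_aeval isSemialgebraic_cube
    (Function.update (fun j => (X j : MvPolynomial (Fin M) ℚ)) i (1 - X i))).congr fun x _ => ?_
  funext j
  rcases eq_or_ne j i with rfl | hj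
  · simp
  · simp [Function.update_of_ne hj]

/-- The reflection move for tame cube representations. [cite: KontsevichZagier2001, §1.2 rule (2)] -/
private theorem rel_reflect_rep (M : ℕ) (i : Fin M) (r r' : IntegralRep M) (hr : r.IsTameCube)
    (hr' : r'.IsTameCube)
    (h : ∀ x ∈ cube M, r.integrand x = r'.integrand (Function.update x i (1 - x i))) :
    KZ.of r - KZ.of r' ∈ KZ.relations := by
  refine cubicalCovGens_subset_relations (mem_cubicalCovGens hr hr'
    (Φ := fun y : Fin M → ℝ => Function.update y i (1 - y i))
    (Φ' := fun _ => (ContinuousLinearMap.id ℝ (Fin M → ℝ) -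
        ((2:ℝ) • ContinuousLinearMap.proj (R := ℝ) (φ := fun _ : Fin M => ℝ) i).smulRight
          (Pi.single i (1:ℝ) : Fin M → ℝ) : (Fin M → ℝ) →L[ℝ] (Fin M → ℝ)))
    (isSemialgebraicMapOn_reflect i) (fun x _ => (hasFDerivAt_reflect i x).hasFDerivWithinAt)
    (fun x _ y _ hxy => ?_) (image_reflect_cube i) (fun j => ?_) fun x hx => ?_)
  · have hx := reflect_reflect i x
    have hy := reflect_reflect i y
    simp only at hxy
    rw [← hx, ← hy, hxy]
  · rcases eq_or_ne j i with rfl | hj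
    · simp only [Function.update_self]
      exact fun x _ => analyticAt_const.sub
        ((ContinuousLinearMap.proj (R := ℝ) (φ := fun _ : Fin M => ℝ) j).analyticAt x)
    · simp only [Function.update_of_ne hj]
      exact fun x _ => (ContinuousLinearMap.proj (R := ℝ) (φ := fun _ : Fin M => ℝ) j).analyticAt x
  · rw [abs_det_reflectDeriv, mul_one]
    exact h x hx

/-- **The reflection move for regular rational functions**: `S(x) = T(x with xᵢ := 1 − xᵢ)` on the
cube gives `[□ᴹ, S] − [□ᴹ, T] ∈ KZ.relations`. [cite: KontsevichZagier2001, §1.2 rule (2)] -/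
private theorem rel_reflect {M : ℕ} (i : Fin M) (T S : RFun M)
    (h : ∀ x ∈ cube M, S.fn x = T.fn (Function.update x i (1 - x i))) :
    KZ.of S.rep - KZ.of T.rep ∈ KZ.relations :=
  rel_reflect_rep M i S.rep T.rep S.isTameCube_rep T.isTameCube_rep h

/-! ## Small tools -/

/-- `update_zero_apply_one`: auxiliary theorem of the lens-6 development «eis» (instances of 28994/4280) — see the module docstring; verbatim from the lens file. -/
@[simp] private theorem update_zero_apply_one (x : Fin 2 → ℝ) (a : ℝ) : Function.update x 0 a 1 = x 1 :=
  Function.update_of_ne (by decide) a x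

/-- `update_one_apply_zero`: auxiliary theorem of the lens-6 development «eis» (instances of 28994/4280) — see the module docstring; verbatim from the lens file. -/
@[simp] private theorem update_one_apply_zero (x : Fin 2 → ℝ) (a : ℝ) : Function.update x 1 a 0 = x 0 :=
  Function.update_of_ne (by decide) a x

/-- A regular rational function gives a KZ-rational representation. [folklore] -/
private theorem isRational_rep {M : ℕ} (T : RFun M) : T.rep.IsRational :=
  ⟨T.num, T.den, T.den_ne, fun _ _ => rfl⟩

/-! ### The polynomials `3 − μ·N` and their positivity on the square -/

/-- `normForm_le_one`: auxiliary theorem of the lens-6 development «eis» (instances of 28994/4280) — see the module docstring; verbatim from the lens file. -/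
private theorem normForm_le_one {a b : ℝ} (ha0 : 0 ≤ a) (ha1 : a ≤ 1) (hb0 : 0 ≤ b) (hb1 : b ≤ 1) :
    a ^ 2 - a * b + b ^ 2 ≤ 1 := by nlinarith [mul_nonneg ha0 hb0, mul_nonneg (sub_nonneg.2 ha1) (sub_nonneg.2 hb1)]

/-- `normForm_nonneg`: auxiliary theorem of the lens-6 development «eis» (instances of 28994/4280) — see the module docstring; verbatim from the lens file. -/
private theorem normForm_nonneg (a b : ℝ) : 0 ≤ a ^ 2 - a * b + b ^ 2 := by nlinarith [sq_nonneg (a - b), sq_nonneg (a + b)]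

/-- `three_sub_pos`: auxiliary theorem of the lens-6 development «eis» (instances of 28994/4280) — see the module docstring; verbatim from the lens file. -/
theorem three_sub_pos {μ : ℚ} (hμ : 0 < μ ∧ μ ≤ 2) {a b : ℝ} (ha0 : 0 ≤ a) (ha1 : a ≤ 1) (hb0 : 0 ≤ b)
    (hb1 : b ≤ 1) : 0 < 3 - (μ : ℝ) * (a ^ 2 - a * b + b ^ 2) := by
  have h1 := normForm_le_one ha0 ha1 hb0 hb1
  have hμ0 : (0 : ℝ) < μ := by exact_mod_cast hμ.1
  have hμ2 : (μ : ℝ) ≤ 2 := by exact_mod_cast hμ.2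
  nlinarith [mul_le_mul_of_nonneg_left h1 hμ0.le]

/-- `3 − μ·N(1−x, 1−y)` (the census denominators: `μ = 2` gives `Q_A`, `μ = 1` gives `Q_B`). -/
def Qorig (μ : ℚ) : MvPolynomial (Fin 2) ℚ :=
  3 - C μ * ((1 - X 0) ^ 2 - (1 - X 0) * (1 - X 1) + (1 - X 1) ^ 2)
/-- `3 − μ·N(x, 1−y)`. -/
def Qmid (μ : ℚ) : MvPolynomial (Fin 2) ℚ := 3 - C μ * (X 0 ^ 2 - X 0 * (1 - X 1) + (1 - X 1) ^ 2)
/-- `3 − μ·N(x, y)`. -/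
def Qfin (μ : ℚ) : MvPolynomial (Fin 2) ℚ := 3 - C μ * (X 0 ^ 2 - X 0 * X 1 + X 1 ^ 2)

section Mu
variable {μ : ℚ} (hμ : 0 < μ ∧ μ ≤ 2)
include hμ

/-- `Qorig_pos`: auxiliary theorem of the lens-6 development «eis» (instances of 28994/4280) — see the module docstring; verbatim from the lens file. -/
theorem Qorig_pos {x : Fin 2 → ℝ} (hx : x ∈ cube 2) : 0 < aeval x (Qorig μ) := by
  have h0 := hx 0; have h1 := hx 1
  simp only [Qorig, map_sub, map_mul, map_add, map_pow, map_ofNat, map_one, aeval_C, aeval_X,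
    eq_ratCast]
  exact three_sub_pos hμ (by linarith [h0.2]) (by linarith [h0.1]) (by linarith [h1.2]) (by linarith [h1.1])

/-- `Qmid_pos`: auxiliary theorem of the lens-6 development «eis» (instances of 28994/4280) — see the module docstring; verbatim from the lens file. -/
private theorem Qmid_pos {x : Fin 2 → ℝ} (hx : x ∈ cube 2) : 0 < aeval x (Qmid μ) := by
  have h0 := hx 0; have h1 := hx 1
  simp only [Qmid, map_sub, map_mul, map_add, map_pow, map_ofNat, map_one, aeval_C, aeval_X,
    eq_ratCast]
  exact three_sub_pos hμ h0.1 h0.2 (by linarith [h1.2]) (by linarith [h1.1])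

/-- `Qfin_pos`: auxiliary theorem of the lens-6 development «eis» (instances of 28994/4280) — see the module docstring; verbatim from the lens file. -/
private theorem Qfin_pos {x : Fin 2 → ℝ} (hx : x ∈ cube 2) : 0 < aeval x (Qfin μ) := by
  have h0 := hx 0; have h1 := hx 1
  simp only [Qfin, map_sub, map_mul, map_add, map_pow, map_ofNat, aeval_C, aeval_X, eq_ratCast]
  exact three_sub_pos hμ h0.1 h0.2 h1.1 h1.2

/-- `[□², 1/(3 − μN(1−x,1−y))]`. -/
def Torig : RFun 2 := ⟨1, Qorig μ, fun _ hx => (Qorig_pos hμ hx).ne'⟩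
/-- `[□², 1/(3 − μN(x,1−y))]`. -/
def Tmid : RFun 2 := ⟨1, Qmid μ, fun _ hx => (Qmid_pos hμ hx).ne'⟩
/-- `[□², 1/(3 − μN(x,y))]`. -/
def Tfin : RFun 2 := ⟨1, Qfin μ, fun _ hx => (Qfin_pos hμ hx).ne'⟩

/-- `Torig_Tmid`: auxiliary theorem of the lens-6 development «eis» (instances of 28994/4280) — see the module docstring; verbatim from the lens file. -/
theorem Torig_Tmid : KZ.of (Torig hμ).rep - KZ.of (Tmid hμ).rep ∈ KZ.relations := by
  refine rel_reflect 0 (Tmid hμ) (Torig hμ) fun x hx => ?_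
  simp only [RFun.fn, Torig, Tmid, Qorig, Qmid, map_sub, map_mul, map_add, map_pow, map_ofNat,
    map_one, aeval_C, aeval_X, eq_ratCast, Function.update_self, update_zero_apply_one]

/-- `Tmid_Tfin`: auxiliary theorem of the lens-6 development «eis» (instances of 28994/4280) — see the module docstring; verbatim from the lens file. -/
theorem Tmid_Tfin : KZ.of (Tmid hμ).rep - KZ.of (Tfin hμ).rep ∈ KZ.relations := by
  refine rel_reflect 1 (Tfin hμ) (Tmid hμ) fun x hx => ?_
  simp only [RFun.fn, Tfin, Tmid, Qfin, Qmid, map_sub, map_mul, map_add, map_pow, map_ofNat,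
    map_one, aeval_C, aeval_X, eq_ratCast, Function.update_self, update_one_apply_zero]

/-- `Tfin_swap`: auxiliary theorem of the lens-6 development «eis» (instances of 28994/4280) — see the module docstring; verbatim from the lens file. -/
theorem Tfin_swap (z : Fin 2 → ℝ) : (Tfin hμ).fn z = (Tfin hμ).fn (z ∘ Equiv.swap 0 1) := by
  simp only [RFun.fn, Tfin, Qfin, map_sub, map_mul, map_add, map_pow, map_ofNat, map_one, aeval_C,
    aeval_X, eq_ratCast, Function.comp_apply, Equiv.swap_apply_left, Equiv.swap_apply_right]
  ring

end Mu

/-! ### Cutting the square along the diagonal and folding by the symmetry `x ↔ y` -/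

/-- The lower triangle `{0 ≤ y ≤ x ≤ 1}`. -/
def Δ₁ : Set (Fin 2 → ℝ) := {z | z ∈ cube 2 ∧ z 1 ≤ z 0}
/-- The upper triangle `{0 ≤ x ≤ y ≤ 1}`. -/
def Δ₂ : Set (Fin 2 → ℝ) := {z | z ∈ cube 2 ∧ z 0 ≤ z 1}

/-- `isSemialgebraic_Δ₁`: auxiliary theorem of the lens-6 development «eis» (instances of 28994/4280) — see the module docstring; verbatim from the lens file. -/
private theorem isSemialgebraic_Δ₁ : IsSemialgebraic ℚ Δ₁ := by
  have h := Literature.ModelTheory.ExponentialFields.isSemialgebraic_setOf_eval_le (k := ℚ) (R := ℝ)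
    (X 1 : MvPolynomial (Fin 2) ℚ) (X 0)
  simp only [aeval_X] at h
  exact isSemialgebraic_cube.inter h

end Geometry

end Summit.KontsevichZagierPeriods.RootDecompQuadraticDescent.EisensteinPair

end
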